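import Summits.Ventures.LatticeQCDFlow.Exactness.IMHAnyStartSplit
import HarnessLib

/-!
# Every start, on path space: after `b` discarded updates the recorded stream of flow-MCMC from ANY initial law is
# the exact mixture `(1 − r^b)·(equilibrium run) + r^b·(residual run)`

HONEST FRAMING: exact (Metropolis-corrected) sampling algorithms for lattice gauge theory;
figures of merit are autocorrelation/cost numbers at stated couplings and volumes; no
continuum-physics claim.

Venture `LatticeQCDFlow` (cell pub-lqcd), topic `Exactness`; FANOUT row 30 (lean-1, GEN-34).  NEW WORK of the
cell, general state space.  GEN-33 (`Exactness/IMHColdStartPathMixture`) proved, for the flow-MCMC chain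
`K = indepMH q w` started AT A MODE `x₀` of the normalised weight `w`, that the law of the whole stream recorded
after `b` discarded updates is EXACTLY `(1 − r^b)·P_π + r^b·P_{x₀}` (`r = 1 − 1/w(x₀)`; path space = Mathlib's
`Kernel.trajMeasure`).  With the exact Doeblin split of `Exactness/IMHAnyStartSplit` (this generation:
`μ₀K^b = (1 − r^b)·π + r^b·μ₀R^b`, `R` the residual kernel of `Literature/…/DoeblinMinorization`) the same holds
FROM EVERY INITIAL LAW, with the residual run in place of the frozen one:

* §1 **`imh_chain_shift_anyStart`** — for every probability law `μ₀` (`w(x₀) > 1`):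
  `P_{μ₀} ∘ θ_b⁻¹ = (1 − r^b)·P_π + r^b·P_{μ₀R^b}` EXACTLY — with probability `1 − r^b` the stream recorded after the
  burn-in IS an equilibrium run, whatever the start; **`imh_chain_shift_anyStart_exists`** — the `R`-free form
  (`w(x₀) ≥ 1`): `P_{μ₀} ∘ θ_b⁻¹ = (1 − r^b)·P_π + r^b·P_ν` for some probability law `ν`;
  **`imh_chain_residual_dirac_mode`** — at `μ₀ = δ_{x₀}` the residual run is the cold-started run
  (`P_{δ_{x₀}R^b} = P_{x₀}`): GEN-33's two-point path law is the modal row of this one.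
* §2 **`imh_chain_shift_integral_anyStart_mem_Icc`** — EVERY BOUNDED STATISTIC FROM EVERY START: for a measurable
  path statistic `F` with `a ≤ F ≤ c` (acceptance fractions, histograms, autocovariance ∕ `τ_int` estimators, error
  bars …): `E_{μ₀}[F(X_{b+·})] − E_π[F] ∈ [r^b·(a − E_π F), r^b·(c − E_π F)]`, so
  (**`imh_chain_shift_integral_anyStart_abs_le`**) `|E_{μ₀}[F(X_{b+·})] − E_π[F]| ≤ r^b·(c − a)` and
  (**`imh_chain_shift_integral_anyStart_abs_le_of_log_le`**) `log(1/ε) ≤ b/w(x₀)` discarded updates leave at most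
  `ε·(c − a)` — THE BURN-IN RULE OF GEN-31/33 HOLDS FROM EVERY START, the hot start (a fresh draw from the flow)
  included.
* §3 events: **`imh_chain_shift_real_anyStart_ge`** — THE LOWER ENVELOPE ON PATH SPACE
  `P_{μ₀}(X_{b+·} ∈ E) ≥ (1 − r^b)·P_π(E)` for every measurable set of runs `E` and every start (one-sided, exact
  constant); **`imh_chain_shift_real_anyStart_le`** (`≤ (1 − r^b)·P_π(E) + r^b`);
  **`imh_chain_shift_real_anyStart_abs_le`** — `|P_{μ₀}(X_{b+·} ∈ E) − P_π(E)| ≤ r^b·max(P_π(E), 1 − P_π(E)) ≤ r^b`.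
Reading (gauge files `Scaling/AutoregressiveGauge…AnyStart`): an exact gauge sampler started from ANY configuration
law — a hot start from its own autoregressive proposal, the last configuration of another run, a deliberately
disordered start — and read after `b` discarded configurations reports every statistic within `(1 − A)^b` × its
range of the equilibrium value, and every property of the equilibrium run is present with at least the fraction `1 − (1 − A)^b` of its
equilibrium probability (the coverage guarantee and "the cold configuration is the worst start" are in the sequel
`Exactness/IMHAnyStartCoverage`).
NOT CLAIMED: the residual law of a specific non-modal start (no closed form is asserted); that a particular
non-modal start is strictly better than the cold one.

No `sorry`, no new definitions, nothing cited as a fact; general measurable space.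
-/

noncomputable section

namespace Summit.Ventures.LatticeQCDFlow.Exactness

open MeasureTheory ProbabilityTheory Function
open scoped ENNReal
open Summit.Ventures.LatticeQCDFlow.Scoring Literature.Probability.MarkovChains

variable {Ω : Type*} [MeasurableSpace Ω] {q : Measure Ω} [IsProbabilityMeasure q] {w : Ω → ℝ}

/-! ## §1 The path law after `b` discarded updates, from every start -/

/-- **THE PATH LAW AFTER `b` DISCARDED UPDATES, FROM EVERY START.**  `w` measurable (a `Fact`), positive,
normalised, maximal at `x₀` with `w(x₀) > 1`; `r = 1 − 1/w(x₀)`; `R` the residual kernel of the exact minorisation.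
For every probability law `μ₀`: `P_{μ₀} ∘ θ_b⁻¹ = (1 − r^b)·P_π + r^b·P_{μ₀R^b}`. [ours] -/
theorem imh_chain_shift_anyStart [Fact (Measurable w)] (hw0 : ∀ y, 0 < w y) {x₀ : Ω} (hmax : ∀ y, w y ≤ w x₀)
    (hlt : 1 < w x₀) [IsProbabilityMeasure (q.withDensity fun y => ENNReal.ofReal (w y))]
    (μ₀ : Measure Ω) [IsProbabilityMeasure μ₀] (b : ℕ) :
    (Kernel.trajMeasure (X := fun _ : ℕ => Ω) μ₀
        (fun n : ℕ => (indepMH q w).comap (fun h : (i : ↥(Finset.Iic n)) → Ω => h ⟨n, Finset.mem_Iic.2 le_rfl⟩)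
          (measurable_pi_apply _))).map (fun (x : ℕ → Ω) (n : ℕ) => x (b + n)) =
      ENNReal.ofReal (1 - (1 - (w x₀)⁻¹) ^ b) •
          Kernel.trajMeasure (X := fun _ : ℕ => Ω) (q.withDensity fun y => ENNReal.ofReal (w y))
            (fun n : ℕ => (indepMH q w).comap (fun h : (i : ↥(Finset.Iic n)) → Ω => h ⟨n, Finset.mem_Iic.2 le_rfl⟩)
              (measurable_pi_apply _)) +
        ENNReal.ofReal ((1 - (w x₀)⁻¹) ^ b) •
          Kernel.trajMeasure (X := fun _ : ℕ => Ω)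
            ((fun m : Measure Ω => m.bind
              (Doeblin.residualKernel (indepMH q w) (q.withDensity fun y => ENNReal.ofReal (w y))
                (ENNReal.ofReal (w x₀)⁻¹) (indepMH_minorised_mode Fact.out hw0 hmax)))^[b] μ₀)
            (fun n : ℕ => (indepMH q w).comap (fun h : (i : ↥(Finset.Iic n)) → Ω => h ⟨n, Finset.mem_Iic.2 le_rfl⟩)
              (measurable_pi_apply _)) := by
  rw [chain_map_shift_eq (indepMH q w) μ₀ b, iterate_bind_indepMH_eq_residual_mixture hw0 hmax hlt b μ₀,
    chain_add_smul]

/-- **`R`-free form, every `w(x₀) ≥ 1`**: `P_{μ₀} ∘ θ_b⁻¹ = (1 − r^b)·P_π + r^b·P_ν` for some probability law `ν`.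
[ours] -/
theorem imh_chain_shift_anyStart_exists [Fact (Measurable w)] (hw0 : ∀ y, 0 < w y) {x₀ : Ω}
    (hmax : ∀ y, w y ≤ w x₀) [IsProbabilityMeasure (q.withDensity fun y => ENNReal.ofReal (w y))]
    (μ₀ : Measure Ω) [IsProbabilityMeasure μ₀] (b : ℕ) :
    ∃ ν : Measure Ω, IsProbabilityMeasure ν ∧
      (Kernel.trajMeasure (X := fun _ : ℕ => Ω) μ₀
          (fun n : ℕ => (indepMH q w).comap (fun h : (i : ↥(Finset.Iic n)) → Ω => h ⟨n, Finset.mem_Iic.2 le_rfl⟩)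
            (measurable_pi_apply _))).map (fun (x : ℕ → Ω) (n : ℕ) => x (b + n)) =
        ENNReal.ofReal (1 - (1 - (w x₀)⁻¹) ^ b) •
            Kernel.trajMeasure (X := fun _ : ℕ => Ω) (q.withDensity fun y => ENNReal.ofReal (w y))
              (fun n : ℕ => (indepMH q w).comap (fun h : (i : ↥(Finset.Iic n)) → Ω => h ⟨n, Finset.mem_Iic.2 le_rfl⟩)
                (measurable_pi_apply _)) +
          ENNReal.ofReal ((1 - (w x₀)⁻¹) ^ b) •
            Kernel.trajMeasure (X := fun _ : ℕ => Ω) ν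
              (fun n : ℕ => (indepMH q w).comap (fun h : (i : ↥(Finset.Iic n)) → Ω => h ⟨n, Finset.mem_Iic.2 le_rfl⟩)
                (measurable_pi_apply _)) := by
  obtain ⟨ν, hν, h⟩ := exists_iterate_bind_indepMH_eq_mixture (q := q) Fact.out hw0 hmax b μ₀
  refine ⟨ν, hν, ?_⟩
  rw [chain_map_shift_eq (indepMH q w) μ₀ b, h, chain_add_smul]

/-- **At the mode the residual run is the cold-started run**: `P_{δ_{x₀}R^b} = P_{x₀}` — GEN-33's
`imh_chain_shift_mode` is `imh_chain_shift_anyStart` at `μ₀ = δ_{x₀}`. [ours] -/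
theorem imh_chain_residual_dirac_mode [Fact (Measurable w)] (hw0 : ∀ y, 0 < w y) {x₀ : Ω}
    (hmax : ∀ y, w y ≤ w x₀) (hlt : 1 < w x₀)
    [IsProbabilityMeasure (q.withDensity fun y => ENNReal.ofReal (w y))] (b : ℕ) :
    Kernel.trajMeasure (X := fun _ : ℕ => Ω)
        ((fun m : Measure Ω => m.bind
          (Doeblin.residualKernel (indepMH q w) (q.withDensity fun y => ENNReal.ofReal (w y))
            (ENNReal.ofReal (w x₀)⁻¹) (indepMH_minorised_mode Fact.out hw0 hmax)))^[b] (Measure.dirac x₀))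
        (fun n : ℕ => (indepMH q w).comap (fun h : (i : ↥(Finset.Iic n)) → Ω => h ⟨n, Finset.mem_Iic.2 le_rfl⟩)
          (measurable_pi_apply _)) =
      Kernel.trajMeasure (X := fun _ : ℕ => Ω) (Measure.dirac x₀)
        (fun n : ℕ => (indepMH q w).comap (fun h : (i : ↥(Finset.Iic n)) → Ω => h ⟨n, Finset.mem_Iic.2 le_rfl⟩)
          (measurable_pi_apply _)) := by
  rw [iterate_bind_residual_dirac_mode hw0 hmax hlt b]

/-! ## §2 Every bounded statistic from every start -/

/-- **EVERY BOUNDED STATISTIC, EVERY START**: for measurable `F` with `a ≤ F ≤ c`,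
`E_{μ₀}[F(X_{b+·})] − E_π[F] ∈ [r^b·(a − E_π F), r^b·(c − E_π F)]`. [ours] -/
theorem imh_chain_shift_integral_anyStart_mem_Icc [Fact (Measurable w)] (hw0 : ∀ y, 0 < w y) {x₀ : Ω}
    (hmax : ∀ y, w y ≤ w x₀) [IsProbabilityMeasure (q.withDensity fun y => ENNReal.ofReal (w y))]
    (μ₀ : Measure Ω) [IsProbabilityMeasure μ₀] {F : (ℕ → Ω) → ℝ} (hF : Measurable F) {a c : ℝ}
    (ha : ∀ x, a ≤ F x) (hc : ∀ x, F x ≤ c) (b : ℕ) :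
    ∫ x, F (fun n => x (b + n)) ∂(Kernel.trajMeasure (X := fun _ : ℕ => Ω) μ₀
        (fun n : ℕ => (indepMH q w).comap (fun h : (i : ↥(Finset.Iic n)) → Ω => h ⟨n, Finset.mem_Iic.2 le_rfl⟩)
          (measurable_pi_apply _))) -
      ∫ x, F x ∂(Kernel.trajMeasure (X := fun _ : ℕ => Ω) (q.withDensity fun y => ENNReal.ofReal (w y))
        (fun n : ℕ => (indepMH q w).comap (fun h : (i : ↥(Finset.Iic n)) → Ω => h ⟨n, Finset.mem_Iic.2 le_rfl⟩)
          (measurable_pi_apply _))) ∈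
      Set.Icc
        ((1 - (w x₀)⁻¹) ^ b * (a - ∫ x, F x ∂(Kernel.trajMeasure (X := fun _ : ℕ => Ω)
            (q.withDensity fun y => ENNReal.ofReal (w y))
            (fun n : ℕ => (indepMH q w).comap (fun h : (i : ↥(Finset.Iic n)) → Ω => h ⟨n, Finset.mem_Iic.2 le_rfl⟩)
              (measurable_pi_apply _)))))
        ((1 - (w x₀)⁻¹) ^ b * (c - ∫ x, F x ∂(Kernel.trajMeasure (X := fun _ : ℕ => Ω)
            (q.withDensity fun y => ENNReal.ofReal (w y))
            (fun n : ℕ => (indepMH q w).comap (fun h : (i : ↥(Finset.Iic n)) → Ω => h ⟨n, Finset.mem_Iic.2 le_rfl⟩)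
              (measurable_pi_apply _))))) := by
  obtain ⟨ν, hν, h⟩ := imh_chain_shift_anyStart_exists (q := q) hw0 hmax μ₀ b
  have hW : 1 ≤ w x₀ := one_le_of_mode (q := q) hmax
  have hr0 : 0 ≤ 1 - (w x₀)⁻¹ := sub_nonneg.2 (inv_le_one_of_one_le₀ hW)
  have hr1 : 1 - (w x₀)⁻¹ ≤ 1 := sub_le_self _ (inv_nonneg.mpr (hw0 x₀).le)
  have hc0 : 0 ≤ 1 - (1 - (w x₀)⁻¹) ^ b := sub_nonneg.2 (pow_le_one₀ hr0 hr1)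
  have hC : ∀ x, |F x| ≤ max |a| |c| := fun x => abs_le_max_abs_abs (ha x) (hc x)
  have hΘ : Measurable (fun (x : ℕ → Ω) (n : ℕ) => x (b + n)) :=
    measurable_pi_lambda _ fun n => measurable_pi_apply _
  rw [← integral_map hΘ.aemeasurable hF.aestronglyMeasurable, h,
    integral_add_measure ((integrable_of_bounded _ hF hC).smul_measure ENNReal.ofReal_ne_top)
      ((integrable_of_bounded _ hF hC).smul_measure ENNReal.ofReal_ne_top),
    integral_smul_measure, integral_smul_measure, ENNReal.toReal_ofReal hc0,
    ENNReal.toReal_ofReal (pow_nonneg hr0 b), smul_eq_mul, smul_eq_mul]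
  set Pπ := Kernel.trajMeasure (X := fun _ : ℕ => Ω) (q.withDensity fun y => ENNReal.ofReal (w y))
    (fun n : ℕ => (indepMH q w).comap (fun h : (i : ↥(Finset.Iic n)) → Ω => h ⟨n, Finset.mem_Iic.2 le_rfl⟩)
      (measurable_pi_apply _))
  set Pν := Kernel.trajMeasure (X := fun _ : ℕ => Ω) ν
    (fun n : ℕ => (indepMH q w).comap (fun h : (i : ↥(Finset.Iic n)) → Ω => h ⟨n, Finset.mem_Iic.2 le_rfl⟩)
      (measurable_pi_apply _))
  have hνa : a ≤ ∫ x, F x ∂Pν := by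
    have := integral_mono (integrable_const a) (integrable_of_bounded Pν hF hC) ha
    rwa [integral_const, probReal_univ, one_smul] at this
  have hνc : ∫ x, F x ∂Pν ≤ c := by
    have := integral_mono (integrable_of_bounded Pν hF hC) (integrable_const c) hc
    rwa [integral_const, probReal_univ, one_smul] at this
  constructor <;> nlinarith [pow_nonneg hr0 b]

/-- **`|E_{μ₀}[F(X_{b+·})] − E_π[F]| ≤ r^b·(c − a)`** for `a ≤ F ≤ c`, from every start. [ours] -/
theorem imh_chain_shift_integral_anyStart_abs_le [Fact (Measurable w)] (hw0 : ∀ y, 0 < w y) {x₀ : Ω}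
    (hmax : ∀ y, w y ≤ w x₀) [IsProbabilityMeasure (q.withDensity fun y => ENNReal.ofReal (w y))]
    (μ₀ : Measure Ω) [IsProbabilityMeasure μ₀] {F : (ℕ → Ω) → ℝ} (hF : Measurable F) {a c : ℝ}
    (ha : ∀ x, a ≤ F x) (hc : ∀ x, F x ≤ c) (b : ℕ) :
    |∫ x, F (fun n => x (b + n)) ∂(Kernel.trajMeasure (X := fun _ : ℕ => Ω) μ₀
        (fun n : ℕ => (indepMH q w).comap (fun h : (i : ↥(Finset.Iic n)) → Ω => h ⟨n, Finset.mem_Iic.2 le_rfl⟩)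
          (measurable_pi_apply _))) -
      ∫ x, F x ∂(Kernel.trajMeasure (X := fun _ : ℕ => Ω) (q.withDensity fun y => ENNReal.ofReal (w y))
        (fun n : ℕ => (indepMH q w).comap (fun h : (i : ↥(Finset.Iic n)) → Ω => h ⟨n, Finset.mem_Iic.2 le_rfl⟩)
          (measurable_pi_apply _)))| ≤ (1 - (w x₀)⁻¹) ^ b * (c - a) := by
  obtain ⟨h1, h2⟩ := imh_chain_shift_integral_anyStart_mem_Icc (q := q) hw0 hmax μ₀ hF ha hc b
  set Pπ := Kernel.trajMeasure (X := fun _ : ℕ => Ω) (q.withDensity fun y => ENNReal.ofReal (w y))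
    (fun n : ℕ => (indepMH q w).comap (fun h : (i : ↥(Finset.Iic n)) → Ω => h ⟨n, Finset.mem_Iic.2 le_rfl⟩)
      (measurable_pi_apply _))
  have hW : 1 ≤ w x₀ := one_le_of_mode (q := q) hmax
  have hr0 : 0 ≤ (1 - (w x₀)⁻¹) ^ b := pow_nonneg (sub_nonneg.2 (inv_le_one_of_one_le₀ hW)) b
  have hC : ∀ x, |F x| ≤ max |a| |c| := fun x => abs_le_max_abs_abs (ha x) (hc x)
  have hπa : a ≤ ∫ x, F x ∂Pπ := by
    have := integral_mono (integrable_const a) (integrable_of_bounded Pπ hF hC) ha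
    rwa [integral_const, probReal_univ, one_smul] at this
  have hπc : ∫ x, F x ∂Pπ ≤ c := by
    have := integral_mono (integrable_of_bounded Pπ hF hC) (integrable_const c) hc
    rwa [integral_const, probReal_univ, one_smul] at this
  rw [abs_le]
  constructor <;> nlinarith

/-- **THE BURN-IN RULE FROM EVERY START**: `log(1/ε) ≤ b/w(x₀)` discarded updates leave
`|E_{μ₀}[F(X_{b+·})] − E_π[F]| ≤ ε·(c − a)` for every statistic with `a ≤ F ≤ c`. [ours] -/
theorem imh_chain_shift_integral_anyStart_abs_le_of_log_le [Fact (Measurable w)] (hw0 : ∀ y, 0 < w y) {x₀ : Ω}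
    (hmax : ∀ y, w y ≤ w x₀) [IsProbabilityMeasure (q.withDensity fun y => ENNReal.ofReal (w y))]
    (μ₀ : Measure Ω) [IsProbabilityMeasure μ₀] {F : (ℕ → Ω) → ℝ} (hF : Measurable F) {a c : ℝ}
    (ha : ∀ x, a ≤ F x) (hc : ∀ x, F x ≤ c) {b : ℕ} {ε : ℝ} (hε : 0 < ε)
    (hb : Real.log (1 / ε) ≤ b * (w x₀)⁻¹) :
    |∫ x, F (fun n => x (b + n)) ∂(Kernel.trajMeasure (X := fun _ : ℕ => Ω) μ₀
        (fun n : ℕ => (indepMH q w).comap (fun h : (i : ↥(Finset.Iic n)) → Ω => h ⟨n, Finset.mem_Iic.2 le_rfl⟩)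
          (measurable_pi_apply _))) -
      ∫ x, F x ∂(Kernel.trajMeasure (X := fun _ : ℕ => Ω) (q.withDensity fun y => ENNReal.ofReal (w y))
        (fun n : ℕ => (indepMH q w).comap (fun h : (i : ↥(Finset.Iic n)) → Ω => h ⟨n, Finset.mem_Iic.2 le_rfl⟩)
          (measurable_pi_apply _)))| ≤ ε * (c - a) := by
  refine (imh_chain_shift_integral_anyStart_abs_le (q := q) hw0 hmax μ₀ hF ha hc b).trans ?_
  have hca : 0 ≤ c - a := by
    have := (ha (fun _ => x₀)).trans (hc (fun _ => x₀))
    linarith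
  exact mul_le_mul_of_nonneg_right (pow_mode_le_of_log_le (q := q) hmax hε hb) hca

/-! ## §3 Events: the lower envelope on path space -/

/-- **Set form from every start**: `P_{μ₀}(X_{b+·} ∈ E) = (1 − r^b)·P_π(E) + r^b·P_ν(E)` for the probability law
`ν` of §1, every measurable set of runs `E`. [ours] -/
theorem imh_chain_shift_real_anyStart_exists [Fact (Measurable w)] (hw0 : ∀ y, 0 < w y) {x₀ : Ω}
    (hmax : ∀ y, w y ≤ w x₀) [IsProbabilityMeasure (q.withDensity fun y => ENNReal.ofReal (w y))]
    (μ₀ : Measure Ω) [IsProbabilityMeasure μ₀] (b : ℕ) :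
    ∃ ν : Measure Ω, IsProbabilityMeasure ν ∧ ∀ {E : Set (ℕ → Ω)}, MeasurableSet E →
      (Kernel.trajMeasure (X := fun _ : ℕ => Ω) μ₀
          (fun n : ℕ => (indepMH q w).comap (fun h : (i : ↥(Finset.Iic n)) → Ω => h ⟨n, Finset.mem_Iic.2 le_rfl⟩)
            (measurable_pi_apply _))).real ((fun (x : ℕ → Ω) (n : ℕ) => x (b + n)) ⁻¹' E) =
        (1 - (1 - (w x₀)⁻¹) ^ b) *
            (Kernel.trajMeasure (X := fun _ : ℕ => Ω) (q.withDensity fun y => ENNReal.ofReal (w y))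
              (fun n : ℕ => (indepMH q w).comap (fun h : (i : ↥(Finset.Iic n)) → Ω => h ⟨n, Finset.mem_Iic.2 le_rfl⟩)
                (measurable_pi_apply _))).real E +
          (1 - (w x₀)⁻¹) ^ b *
            (Kernel.trajMeasure (X := fun _ : ℕ => Ω) ν
              (fun n : ℕ => (indepMH q w).comap (fun h : (i : ↥(Finset.Iic n)) → Ω => h ⟨n, Finset.mem_Iic.2 le_rfl⟩)
                (measurable_pi_apply _))).real E := by
  obtain ⟨ν, hν, h⟩ := imh_chain_shift_anyStart_exists (q := q) hw0 hmax μ₀ b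
  have hW : 1 ≤ w x₀ := one_le_of_mode (q := q) hmax
  have hr0 : 0 ≤ 1 - (w x₀)⁻¹ := sub_nonneg.2 (inv_le_one_of_one_le₀ hW)
  have hr1 : 1 - (w x₀)⁻¹ ≤ 1 := sub_le_self _ (inv_nonneg.mpr (hw0 x₀).le)
  have hc0 : 0 ≤ 1 - (1 - (w x₀)⁻¹) ^ b := sub_nonneg.2 (pow_le_one₀ hr0 hr1)
  have hΘ : Measurable (fun (x : ℕ → Ω) (n : ℕ) => x (b + n)) :=
    measurable_pi_lambda _ fun n => measurable_pi_apply _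
  refine ⟨ν, hν, fun {E} hE => ?_⟩
  rw [← map_measureReal_apply hΘ hE, h]
  simp only [measureReal_def]
  rw [Measure.add_apply, Measure.smul_apply, Measure.smul_apply, smul_eq_mul, smul_eq_mul,
    ENNReal.toReal_add (ENNReal.mul_ne_top ENNReal.ofReal_ne_top (measure_ne_top _ _))
      (ENNReal.mul_ne_top ENNReal.ofReal_ne_top (measure_ne_top _ _)),
    ENNReal.toReal_mul, ENNReal.toReal_mul, ENNReal.toReal_ofReal hc0, ENNReal.toReal_ofReal (pow_nonneg hr0 b)]

/-- **THE LOWER ENVELOPE ON PATH SPACE**: `P_{μ₀}(X_{b+·} ∈ E) ≥ (1 − r^b)·P_π(E)` for every measurable set of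
runs and every start — after `b` discarded updates every property of the equilibrium run is present with at least
the fraction `1 − r^b` of its equilibrium probability. [ours] -/
theorem imh_chain_shift_real_anyStart_ge [Fact (Measurable w)] (hw0 : ∀ y, 0 < w y) {x₀ : Ω}
    (hmax : ∀ y, w y ≤ w x₀) [IsProbabilityMeasure (q.withDensity fun y => ENNReal.ofReal (w y))]
    (μ₀ : Measure Ω) [IsProbabilityMeasure μ₀] {E : Set (ℕ → Ω)} (hE : MeasurableSet E) (b : ℕ) :
    (1 - (1 - (w x₀)⁻¹) ^ b) *
        (Kernel.trajMeasure (X := fun _ : ℕ => Ω) (q.withDensity fun y => ENNReal.ofReal (w y))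
          (fun n : ℕ => (indepMH q w).comap (fun h : (i : ↥(Finset.Iic n)) → Ω => h ⟨n, Finset.mem_Iic.2 le_rfl⟩)
            (measurable_pi_apply _))).real E ≤
      (Kernel.trajMeasure (X := fun _ : ℕ => Ω) μ₀
        (fun n : ℕ => (indepMH q w).comap (fun h : (i : ↥(Finset.Iic n)) → Ω => h ⟨n, Finset.mem_Iic.2 le_rfl⟩)
          (measurable_pi_apply _))).real ((fun (x : ℕ → Ω) (n : ℕ) => x (b + n)) ⁻¹' E) := by
  obtain ⟨ν, hν, h⟩ := imh_chain_shift_real_anyStart_exists (q := q) hw0 hmax μ₀ b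
  have hW : 1 ≤ w x₀ := one_le_of_mode (q := q) hmax
  have hr0 : 0 ≤ 1 - (w x₀)⁻¹ := sub_nonneg.2 (inv_le_one_of_one_le₀ hW)
  rw [h hE]
  exact le_add_of_nonneg_right (mul_nonneg (pow_nonneg hr0 b) measureReal_nonneg)

/-- **Upper envelope**: `P_{μ₀}(X_{b+·} ∈ E) ≤ (1 − r^b)·P_π(E) + r^b`. [ours] -/
theorem imh_chain_shift_real_anyStart_le [Fact (Measurable w)] (hw0 : ∀ y, 0 < w y) {x₀ : Ω}
    (hmax : ∀ y, w y ≤ w x₀) [IsProbabilityMeasure (q.withDensity fun y => ENNReal.ofReal (w y))]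
    (μ₀ : Measure Ω) [IsProbabilityMeasure μ₀] {E : Set (ℕ → Ω)} (hE : MeasurableSet E) (b : ℕ) :
    (Kernel.trajMeasure (X := fun _ : ℕ => Ω) μ₀
        (fun n : ℕ => (indepMH q w).comap (fun h : (i : ↥(Finset.Iic n)) → Ω => h ⟨n, Finset.mem_Iic.2 le_rfl⟩)
          (measurable_pi_apply _))).real ((fun (x : ℕ → Ω) (n : ℕ) => x (b + n)) ⁻¹' E) ≤
      (1 - (1 - (w x₀)⁻¹) ^ b) *
          (Kernel.trajMeasure (X := fun _ : ℕ => Ω) (q.withDensity fun y => ENNReal.ofReal (w y))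
            (fun n : ℕ => (indepMH q w).comap (fun h : (i : ↥(Finset.Iic n)) → Ω => h ⟨n, Finset.mem_Iic.2 le_rfl⟩)
              (measurable_pi_apply _))).real E + (1 - (w x₀)⁻¹) ^ b := by
  obtain ⟨ν, hν, h⟩ := imh_chain_shift_real_anyStart_exists (q := q) hw0 hmax μ₀ b
  have hW : 1 ≤ w x₀ := one_le_of_mode (q := q) hmax
  have hr0 : 0 ≤ 1 - (w x₀)⁻¹ := sub_nonneg.2 (inv_le_one_of_one_le₀ hW)
  rw [h hE]
  have : (1 - (w x₀)⁻¹) ^ b *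
      (Kernel.trajMeasure (X := fun _ : ℕ => Ω) ν
        (fun n : ℕ => (indepMH q w).comap (fun h : (i : ↥(Finset.Iic n)) → Ω => h ⟨n, Finset.mem_Iic.2 le_rfl⟩)
          (measurable_pi_apply _))).real E ≤ (1 - (w x₀)⁻¹) ^ b * 1 :=
    mul_le_mul_of_nonneg_left measureReal_le_one (pow_nonneg hr0 b)
  linarith

/-- **`|P_{μ₀}(X_{b+·} ∈ E) − P_π(E)| ≤ r^b·max(P_π(E), 1 − P_π(E))`** from every start. [ours] -/
theorem imh_chain_shift_real_anyStart_abs_le [Fact (Measurable w)] (hw0 : ∀ y, 0 < w y) {x₀ : Ω}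
    (hmax : ∀ y, w y ≤ w x₀) [IsProbabilityMeasure (q.withDensity fun y => ENNReal.ofReal (w y))]
    (μ₀ : Measure Ω) [IsProbabilityMeasure μ₀] {E : Set (ℕ → Ω)} (hE : MeasurableSet E) (b : ℕ) :
    |(Kernel.trajMeasure (X := fun _ : ℕ => Ω) μ₀
        (fun n : ℕ => (indepMH q w).comap (fun h : (i : ↥(Finset.Iic n)) → Ω => h ⟨n, Finset.mem_Iic.2 le_rfl⟩)
          (measurable_pi_apply _))).real ((fun (x : ℕ → Ω) (n : ℕ) => x (b + n)) ⁻¹' E) -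
      (Kernel.trajMeasure (X := fun _ : ℕ => Ω) (q.withDensity fun y => ENNReal.ofReal (w y))
        (fun n : ℕ => (indepMH q w).comap (fun h : (i : ↥(Finset.Iic n)) → Ω => h ⟨n, Finset.mem_Iic.2 le_rfl⟩)
          (measurable_pi_apply _))).real E| ≤
      (1 - (w x₀)⁻¹) ^ b *
        max ((Kernel.trajMeasure (X := fun _ : ℕ => Ω) (q.withDensity fun y => ENNReal.ofReal (w y))
            (fun n : ℕ => (indepMH q w).comap (fun h : (i : ↥(Finset.Iic n)) → Ω => h ⟨n, Finset.mem_Iic.2 le_rfl⟩)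
              (measurable_pi_apply _))).real E)
          (1 - (Kernel.trajMeasure (X := fun _ : ℕ => Ω) (q.withDensity fun y => ENNReal.ofReal (w y))
            (fun n : ℕ => (indepMH q w).comap (fun h : (i : ↥(Finset.Iic n)) → Ω => h ⟨n, Finset.mem_Iic.2 le_rfl⟩)
              (measurable_pi_apply _))).real E) := by
  have h1 := imh_chain_shift_real_anyStart_ge (q := q) hw0 hmax μ₀ hE b
  have h2 := imh_chain_shift_real_anyStart_le (q := q) hw0 hmax μ₀ hE b
  set Pπ := Kernel.trajMeasure (X := fun _ : ℕ => Ω) (q.withDensity fun y => ENNReal.ofReal (w y))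
    (fun n : ℕ => (indepMH q w).comap (fun h : (i : ↥(Finset.Iic n)) → Ω => h ⟨n, Finset.mem_Iic.2 le_rfl⟩)
      (measurable_pi_apply _))
  have hW : 1 ≤ w x₀ := one_le_of_mode (q := q) hmax
  have hr0 : 0 ≤ (1 - (w x₀)⁻¹) ^ b := pow_nonneg (sub_nonneg.2 (inv_le_one_of_one_le₀ hW)) b
  have hm1 := mul_le_mul_of_nonneg_left (le_max_left (Pπ.real E) (1 - Pπ.real E)) hr0
  have hm2 := mul_le_mul_of_nonneg_left (le_max_right (Pπ.real E) (1 - Pπ.real E)) hr0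
  rw [abs_le]
  constructor <;> nlinarith

/-- … hence `|P_{μ₀}(X_{b+·} ∈ E) − P_π(E)| ≤ r^b` for every start and every measurable set of runs. [ours] -/
theorem imh_chain_shift_real_anyStart_abs_le' [Fact (Measurable w)] (hw0 : ∀ y, 0 < w y) {x₀ : Ω}
    (hmax : ∀ y, w y ≤ w x₀) [IsProbabilityMeasure (q.withDensity fun y => ENNReal.ofReal (w y))]
    (μ₀ : Measure Ω) [IsProbabilityMeasure μ₀] {E : Set (ℕ → Ω)} (hE : MeasurableSet E) (b : ℕ) :
    |(Kernel.trajMeasure (X := fun _ : ℕ => Ω) μ₀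
        (fun n : ℕ => (indepMH q w).comap (fun h : (i : ↥(Finset.Iic n)) → Ω => h ⟨n, Finset.mem_Iic.2 le_rfl⟩)
          (measurable_pi_apply _))).real ((fun (x : ℕ → Ω) (n : ℕ) => x (b + n)) ⁻¹' E) -
      (Kernel.trajMeasure (X := fun _ : ℕ => Ω) (q.withDensity fun y => ENNReal.ofReal (w y))
        (fun n : ℕ => (indepMH q w).comap (fun h : (i : ↥(Finset.Iic n)) → Ω => h ⟨n, Finset.mem_Iic.2 le_rfl⟩)
          (measurable_pi_apply _))).real E| ≤ (1 - (w x₀)⁻¹) ^ b := by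
  refine (imh_chain_shift_real_anyStart_abs_le (q := q) hw0 hmax μ₀ hE b).trans ?_
  have hW : 1 ≤ w x₀ := one_le_of_mode (q := q) hmax
  have hr0 : 0 ≤ (1 - (w x₀)⁻¹) ^ b := pow_nonneg (sub_nonneg.2 (inv_le_one_of_one_le₀ hW)) b
  exact mul_le_of_le_one_right hr0 (max_le measureReal_le_one (sub_le_self _ measureReal_nonneg))

end Summit.Ventures.LatticeQCDFlow.Exactness

end
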